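import Summits.QuantumFields.BalabanUV.T4Continuum.Support.SubstrateAvgTowerRegularitySecond
import Summits.QuantumFields.BalabanUV.T4Continuum.Support.B13ReadingsAvgTowerSecondBavgUniform
import Summits.QuantumFields.BalabanUV.T4Continuum.Support.B13AvgCorrPlaquette

/-!
# SUBSTRATE — W-28c: THE LETTER-ONLY WINDOWED `hloc` FOR THE AVERAGING TOWER OF RECORD — (ℓ2) AND (ℓ4) DISCHARGED, κ₁ IN THE JUNCTION CURRENCY J-σ₁

Cell `pub-balaban`, SUBSTRATE cell.  Summits-side under the LEAN PLACEMENT RULE.  Pure plumbing over W-28b `SubstrateAvgTowerRegularitySecond` (`secondOrderLetters_avgTower`,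
`hloc_avgTower_on_window4` — (ℓ2) discharged by the NE5 owner's FILE A, (ℓ4) `hbavgD` still DISPLAYED, κ₁ displayed in FILE A's matrix currency at `CfOf`), the owner's g40-σ FILE B2
`B13ReadingsAvgTowerSecondBavgUniform` (`hbavgD_of_factorisation`: (ℓ4) ON THE LEVEL WINDOW `k < Kf` from `FactorisationData` + `SecondOrderLetters` for lines starting IN THE BLOCK) and κ-L2
`B13AvgCorrPlaquette` (`norm_mul_unitary`).
§1 (substrate-p3 g5's pieces, OFFER l.25534 `substrate/p3/W28bV2Pieces.scratch.lean` b1d572240d6a7dc0, RULING R62 (a)∕(b) l.25750 «THIS SHAPE»): `siteIdx_symm_add_unitVec`, **`CfOf_tau`** (below the finest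
level the shifted coarse index reads the correction of the SHIFTED bond), the conversion `‖ι C′ − ι C‖ = dist1 (C′·C⁻¹)` (unitary `dist1`-realising `ι`; = the tree's `B13AvgCorrKappaOneLetters.norm_map_sub_map`, inlined — no restatement), **`corr_shift_clause`** = THE JUNCTION J-σ₁ OF
RECORD: the DISPLAYED scaled same-field shifted-bond letter `hκ₁ : j + 1 + k = K → dist1 (corr ℰ (avgTower ℰ V j) ⟨x.shift ν, μ⟩ · (corr ℰ (avgTower ℰ V j) ⟨x, μ⟩)⁻¹) · (lev L k)³ ≤ κ₁` (σ-END's target form, NE5 leaf-09-g20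
`B13AvgCorrKappaOne`) ⟹ `SecondOrderLetters.corr_shift` at `CfOf` (`‖CfOf k μ (τ_ν i) − CfOf k μ i‖ ≤ κ₁∕(lev L k)³`, `k < K`).
§2 **`hbavgD_avgTower`**: the owner's FILE B2 END at W-25b's `factorisationData_avgTower` + W-28b's `secondOrderLetters_avgTower`, block-start hypothesis `hst` discharged by `rfl` at PART 3's
`stOf P k μ i := cpt i.1 + off (const (L−1)∕2)` (`j₀ := const (L−1)∕2`) — W-25b §2's (ℓ4) binder PRODUCED on `levelWindow P.K` (`k + 1 ≤ K ⟺ k < K`, `lt_of_mem_levelWindow`), constant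
`γD = (2d+2)·βD + (4∕3)(κ₁ + (2α′+9κ)(2β′+16κ))`, `βD = 2(β″+16β′²) + 8(κ₁+9κ(2β′+16κ))`.
§3 **`hloc_avgTower_on_window5[_dom]`** — THE END WITH NO DISPLAYED TOWER BINDER: IN the five letters of record hα′, hβ′ ((3.35) shapes), hβ″ = `SecondOrderWindow P ι V β''` ((3.36) shape, W-28a), hκ (SCALED plaquette
letter, J-κ — κ-END `B13AvgCorrKappa`), hκ₁ (J-σ₁ display above — σ-END), unitary `dist1`-realising `ι` (`hι`, `hdist`), `2 ≤ L`, `α′ ≤ 1∕16`, `κ ≤ 1∕64`; OUT `LocalRateOn (levelWindow P.K) (bgReadings (regClass (towerOf P ι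
(avgTower ℰ V)))) C L⁻¹` with W-25b's constant at (βD, γD) above.  With this file the substrate half of O1 ∕ J-avg-reg displays NOTHING about the tower: what remains displayed on row NE5's road through NE2's
bridge is exactly the five WINDOW LETTERS (two of them, κ and κ₁, being NE5-swarm targets in flight) — plus NE2 ROOT-B itself (owner R62).

HONEST FRAMING.  [folklore] group algebra + bookkeeping: §1 is substrate-p3's (re-homed here with attribution; p3 files this module), §2–§3 are one-line applications of the NE5 owner's
FILE B2 ∕ W-28b.  NO estimate of any NE row is proved substrate-side: the window letters are HYPOTHESES; nothing of [Balaban1985Averaging] (3.35)–(3.36) or [Balaban1989LargeFieldRG2] is instantiated; the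
thresholds are the owner's bookkeeping thresholds, not Bałaban's.  Row NE5 (M1-real⁺) and row NE2 ROOT-B are NOT PRINTED and NOT PROVED here; spine 0∕9; rung (B)+1 on FINITE T⁴ only — NOT infinite volume, NOT
a mass gap, NOT the Clay problem.
-/

noncomputable section

open scoped BigOperators Matrix Matrix.Norms.L2Operator

open Literature.MathematicalPhysics.QuantumFieldTheory.Balaban1983to89
open Literature.MathematicalPhysics.QuantumFieldTheory.Balaban1983to89.B5Prop11Plancherel (Tor fine unitVec)
open Literature.MathematicalPhysics.QuantumFieldTheory.Balaban1983to89.B5G183RateUnitTower (lev lev_neZero)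
open Literature.MathematicalPhysics.QuantumFieldTheory.Balaban1983to89.BlockAveraging (corr)
open Summit.QuantumFields.BalabanUV.T4Continuum
open Summit.QuantumFields.BalabanUV.T4Continuum.BalabanAveragedTowerUnit (idx one_le_lev')
open Summit.QuantumFields.BalabanUV.T4Continuum.NE2BalabanGauge (liftR)
open Summit.QuantumFields.BalabanUV.T4Continuum.SubstrateBackgroundTransporters (unitMod towerOf siteIdx siteIdx_shift)
open Summit.QuantumFields.BalabanUV.T4Continuum.SubstrateLocalRateOn (LocalRateOn levelWindow lt_of_mem_levelWindow)
open Summit.QuantumFields.BalabanUV.T4Continuum.BlockPairingGeometry (tau)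
open Summit.QuantumFields.BalabanUV.T4Continuum.CovariantLinePlanting (bavg)
open Summit.QuantumFields.BalabanUV.T4Continuum.NE2FromNE3 (bgReadings)
open Summit.QuantumFields.BalabanUV.T4Continuum.RegularBackgroundTower (dconnTower regClass)
open Summit.QuantumFields.BalabanUV.T4Continuum.SubstrateAvgTowerStructure (avgTower axialTower)
open Summit.QuantumFields.BalabanUV.T4Continuum.SubstrateAvgTowerPlumbing (towerOfS liftR_towerOfS)
open Summit.QuantumFields.BalabanUV.T4Continuum.SubstrateAvgTowerRegularity (hloc_avgTower_on_levelWindow)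
open Summit.QuantumFields.BalabanUV.T4Continuum.SubstrateSecondOrderWindow (SecondOrderWindow fin_second_clause)
open Summit.QuantumFields.BalabanUV.T4Continuum.SubstrateAvgTowerFactorisation (CfOf stOf CfOf_of_lt CfOf_of_le half_lt_L)
open Summit.QuantumFields.BalabanUV.T4Continuum.SubstrateAvgTowerRegularity (factorisationData_avgTower)
open Summit.QuantumFields.BalabanUV.T4Continuum.B13ReadingsAvgTowerSecondUniform (SecondOrderLetters hlipD_of_factorisation)

open Summit.QuantumFields.BalabanUV.T4Continuum.SubstrateAvgTowerRegularitySecond (secondOrderLetters_avgTower hloc_avgTower_on_window4)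
open Summit.QuantumFields.BalabanUV.T4Continuum.B13ReadingsAvgTowerSecondBavgUniform (hbavgD_of_factorisation)
open Summit.QuantumFields.BalabanUV.T4Continuum.B13AvgCorrPlaquette (norm_mul_unitary)

namespace Summit.QuantumFields.BalabanUV.T4Continuum.SubstrateAvgTowerRegularityLetters

section Pieces

/-! ## §1 The junction J-σ₁: `corr_shift` at the datum from the dist1-quotient display (substrate-p3 g5) -/

variable {P : Params} {G : Type*} [GaugeGroup G] {o : Type*} [Fintype o] [DecidableEq o] (ι : G →* Matrix o o ℂ) (ℰ : LoopAverage G)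

/-- [folklore] the inverse chart commutes with unit shifts: `e⁻¹ (y + e_ν) = (e⁻¹ y).shift ν`. -/
theorem siteIdx_symm_add_unitVec {j k : ℕ} (h : j + k = P.K) (y : Tor (fine (lev P.L k) (unitMod P))) (ν : Fin P.d) :
    (siteIdx P h).symm (y + unitVec _ ν) = ((siteIdx P h).symm y).shift ν := by
  apply (siteIdx P h).injective
  rw [Equiv.apply_symm_apply, siteIdx_shift, Equiv.apply_symm_apply]

/-- [folklore] **THE SHIFTED CORRECTION AT THE DATUM**: below the finest level, `CfOf k μ (τ_ν i) = ι (corr ℰ U_j ⟨(e⁻¹ i.1).shift ν, μ⟩)`, `j + 1 = K − k`. -/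
theorem CfOf_tau (V : GaugeField P 0 G) {k : ℕ} (hk : k < P.K) (μ ν : Fin P.d) (i : idx P.L (unitMod P) k) :
    CfOf ι ℰ V k μ (tau (fine (lev P.L k) (unitMod P)) ν i)
      = ι (corr ℰ (avgTower ℰ V (P.K - (k + 1)))
          ⟨((siteIdx P (j := P.K - (k + 1) + 1) (k := k) (by omega)).symm i.1).shift ν, μ⟩) := by
  rw [CfOf_of_lt ι ℰ V hk, ← siteIdx_symm_add_unitVec]
  rfl

/-- [folklore] **`corr_shift` AT THE DATUM FROM A dist1-QUOTIENT DISPLAY**: a displayed scaled letter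
`dist1 (corr U_j ⟨x + e_ν, μ⟩ · (corr U_j ⟨x, μ⟩)⁻¹) · (lev L k)³ ≤ κ₁` (coarse NE2 level `k`, `j + 1 + k = K`) gives, for unitary `dist1`-realising `ι`,
`‖CfOf k μ (τ_ν i) − CfOf k μ i‖ ≤ κ₁ ∕ (lev L k)³` at every `k < K` (and `0 ≤ …` trivially at `k ≥ K`, where `CfOf = 1`). -/
theorem corr_shift_clause (hι : ∀ g, ι g ∈ Matrix.unitaryGroup o ℂ) (hdist : ∀ g, ‖ι g - 1‖ = dist1 g) (V : GaugeField P 0 G) {κ₁ : ℝ}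
    (hκ₁ : ∀ (j k : ℕ), j + 1 + k = P.K → ∀ (x : Site P (j + 1)) (μ ν : Fin P.d),
      dist1 (corr ℰ (avgTower ℰ V j) ⟨x.shift ν, μ⟩ * (corr ℰ (avgTower ℰ V j) ⟨x, μ⟩)⁻¹) * ((lev P.L k : ℕ) : ℝ) ^ 3 ≤ κ₁)
    {k : ℕ} (hk : k < P.K) (μ ν : Fin P.d) (i : idx P.L (unitMod P) k) :
    ‖CfOf ι ℰ V k μ (tau (fine (lev P.L k) (unitMod P)) ν i) - CfOf ι ℰ V k μ i‖ ≤ κ₁ / ((lev P.L k : ℕ) : ℝ) ^ 3 := by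
  have hℓ : (0 : ℝ) < ((lev P.L k : ℕ) : ℝ) ^ 3 := pow_pos (by exact_mod_cast one_le_lev' P.L k) 3
  -- matrix currency ⇐ dist1-quotient (unitary, `dist1`-realising `ι`): `‖ι C′ − ι C‖ = dist1 (C′·C⁻¹)` — the tree's
  -- `B13AvgCorrKappaOneLetters.norm_map_sub_map` (σ-END PART 1, leaf-09); inlined here to keep this module off the σ-chain's imports.
  have hconv : ∀ C C' : G, ‖ι C' - ι C‖ = dist1 (C' * C⁻¹) := fun C C' => by
    have h : ι C' - ι C = (ι (C' * C⁻¹) - 1) * ι C := by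
      rw [sub_mul, one_mul, ← map_mul, inv_mul_cancel_right]
    rw [h, norm_mul_unitary _ (hι C), hdist]
  rw [CfOf_tau ι ℰ V hk, CfOf_of_lt ι ℰ V hk, hconv, le_div_iff₀ hℓ]
  exact hκ₁ _ k (by omega) _ μ ν

end Pieces

variable (P : Params) {G : Type*} [GaugeGroup G] {o : Type*} [Fintype o] [DecidableEq o] (ι : G →* Matrix o o ℂ) (ℰ : LoopAverage G)

/-! ## §2 (ℓ4) on the level window for the averaging tower of record -/

/-- [folklore] **(ℓ4) ON THE LEVEL WINDOW FOR THE AVERAGING TOWER OF RECORD** — the owner's FILE B2 `hbavgD_of_factorisation` at W-25b's `factorisationData_avgTower` and W-28b's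
`secondOrderLetters_avgTower` (block-start hypothesis `rfl` at `stOf`): `‖bavg (dconnTower R (k+1) μ) y − dconnTower R k μ y‖ ≤ γD∕lev L k` for `k ∈ levelWindow K`. -/
theorem hbavgD_avgTower (hdist : ∀ g, ‖ι g - 1‖ = dist1 g) (hL : 2 ≤ P.L) (V : GaugeField P 0 G) {α' β' κ β'' κ₁ : ℝ}
    (hα0 : 0 ≤ α') (hα : α' ≤ 1 / 16) (hβ0 : 0 ≤ β') (hκ0 : 0 ≤ κ) (hκ1 : κ ≤ 1 / 64) (hβ''0 : 0 ≤ β'') (hκ₁0 : 0 ≤ κ₁)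
    (hα' : ∀ b : PBond P 0, (P.L : ℝ) ^ P.K * dist1 (V b) ≤ α')
    (hβ' : ∀ (x : Site P 0) (ν μ : Fin P.d), (P.L : ℝ) ^ P.K * ‖ι (V ⟨x.shift μ, ν⟩) - ι (V ⟨x, ν⟩)‖ ≤ β' / (P.L : ℝ) ^ P.K)
    (hβ'' : SecondOrderWindow P ι V β'')
    (hκ : ∀ (i k : ℕ), i + 1 + k = P.K → ∀ c : PBond P (i + 1), dist1 (corr ℰ (avgTower ℰ V i) c) * ((lev P.L k : ℕ) : ℝ) ^ 2 ≤ κ)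
    (hκ₁ : ∀ k < P.K, ∀ μ ν (i : idx P.L (unitMod P) k),
      ‖CfOf ι ℰ V k μ (tau (fine (lev P.L k) (unitMod P)) ν i) - CfOf ι ℰ V k μ i‖ ≤ κ₁ / ((lev P.L k : ℕ) : ℝ) ^ 3) :
    ∀ k ∈ levelWindow P.K, ∀ μ (y : idx P.L (unitMod P) k),
      ‖bavg (lev P.L k) P.L (unitMod P) (dconnTower P.L (unitMod P) (towerOf P ι (avgTower ℰ V)) (k + 1) μ) y
        - dconnTower P.L (unitMod P) (towerOf P ι (avgTower ℰ V)) k μ y‖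
        ≤ ((2 * P.d + 2) * (2 * (β'' + 16 * β' ^ 2) + 8 * (κ₁ + 9 * κ * (2 * β' + 16 * κ)))
          + 4 / 3 * (κ₁ + (2 * α' + 9 * κ) * (2 * β' + 16 * κ))) / (lev P.L k : ℕ) :=
  fun k hk μ y =>
    hbavgD_of_factorisation P.L (unitMod P) (factorisationData_avgTower P ι ℰ hdist V hα0 hβ0 hα' hβ' hκ)
      (secondOrderLetters_avgTower P ι ℰ V hβ''0 hβ'' hκ₁) (j₀ := fun _ _ _ _ => ⟨(P.L - 1) / 2, half_lt_L P⟩) (fun _ _ _ _ => rfl)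
      hL hα0 hα hβ0 hβ''0 hκ0 hκ1 hκ₁0 k (lt_of_mem_levelWindow hk) μ y

/-! ## §3 The letter-only windowed `hloc` -/

/-- [folklore] **THE LETTER-ONLY WINDOWED `hloc` FOR THE AVERAGING TOWER OF RECORD**: from the five window letters (α′, β′, β″, κ, κ₁ — κ₁ in the junction currency J-σ₁), a unitary
`dist1`-realising `ι`, `2 ≤ L`, `α′ ≤ 1∕16`, `κ ≤ 1∕64`: `LocalRateOn (levelWindow K) (bgReadings (regClass (towerOf P ι (avgTower ℰ V)))) C L⁻¹` — W-28b `hloc_avgTower_on_window4` with its κ₁ binder fed by §1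
`corr_shift_clause` and its (ℓ4) binder fed by §2. NO displayed tower binder remains. -/
theorem hloc_avgTower_on_window5 (hι : ∀ g, ι g ∈ Matrix.unitaryGroup o ℂ) (hdist : ∀ g, ‖ι g - 1‖ = dist1 g) (hL : 2 ≤ P.L) (V : GaugeField P 0 G)
    {α' β' κ β'' κ₁ : ℝ} (hα0 : 0 ≤ α') (hα : α' ≤ 1 / 16) (hβ0 : 0 ≤ β') (hκ0 : 0 ≤ κ) (hκ1 : κ ≤ 1 / 64) (hβ''0 : 0 ≤ β'') (hκ₁0 : 0 ≤ κ₁)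
    (hα' : ∀ b : PBond P 0, (P.L : ℝ) ^ P.K * dist1 (V b) ≤ α')
    (hβ' : ∀ (x : Site P 0) (ν μ : Fin P.d), (P.L : ℝ) ^ P.K * ‖ι (V ⟨x.shift μ, ν⟩) - ι (V ⟨x, ν⟩)‖ ≤ β' / (P.L : ℝ) ^ P.K)
    (hβ'' : SecondOrderWindow P ι V β'')
    (hκ : ∀ (i k : ℕ), i + 1 + k = P.K → ∀ c : PBond P (i + 1), dist1 (corr ℰ (avgTower ℰ V i) c) * ((lev P.L k : ℕ) : ℝ) ^ 2 ≤ κ)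
    (hκ₁ : ∀ (j k : ℕ), j + 1 + k = P.K → ∀ (x : Site P (j + 1)) (μ ν : Fin P.d),
      dist1 (corr ℰ (avgTower ℰ V j) ⟨x.shift ν, μ⟩ * (corr ℰ (avgTower ℰ V j) ⟨x, μ⟩)⁻¹) * ((lev P.L k : ℕ) : ℝ) ^ 3 ≤ κ₁) :
    LocalRateOn (levelWindow P.K) (bgReadings P.L (unitMod P) (regClass P.L (unitMod P) (towerOf P ι (avgTower ℰ V))))
      (max (κ * Real.exp (2 * α' + 8 * κ) + (2 * α' + 8 * κ) ^ 2 + (2 * P.d + 1) * (2 * β' + 16 * κ))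
        ((2 * P.d + 2) * (2 * (β'' + 16 * β' ^ 2) + 8 * (κ₁ + 9 * κ * (2 * β' + 16 * κ)))
          + 4 / 3 * (κ₁ + (2 * α' + 9 * κ) * (2 * β' + 16 * κ)))
        + 2 * P.d * max (2 * β' + 16 * κ) (2 * (β'' + 16 * β' ^ 2) + 8 * (κ₁ + 9 * κ * (2 * β' + 16 * κ))))
      ((P.L : ℝ)⁻¹) :=
  have hκ₁' : ∀ k < P.K, ∀ μ ν (i : idx P.L (unitMod P) k),
      ‖CfOf ι ℰ V k μ (tau (fine (lev P.L k) (unitMod P)) ν i) - CfOf ι ℰ V k μ i‖ ≤ κ₁ / ((lev P.L k : ℕ) : ℝ) ^ 3 :=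
    fun _ hk μ ν i => corr_shift_clause ι ℰ hι hdist V hκ₁ hk μ ν i
  hloc_avgTower_on_window4 P ι ℰ hdist hL V hα0 hα hβ0 hκ0 hκ1 hβ''0 hκ₁0 hα' hβ' hβ'' hκ hκ₁'
    (hbavgD_avgTower P ι ℰ hdist hL V hα0 hα hβ0 hκ0 hκ1 hβ''0 hκ₁0 hα' hβ' hβ'' hκ hκ₁')

/-- [folklore] … in the `∀ b ∈ dom` binder shape at `RgV b := towerOfS P ι (avgTower ℰ (fld b))`. -/
theorem hloc_avgTower_on_window5_dom (hι : ∀ g, ι g ∈ Matrix.unitaryGroup o ℂ) (hdist : ∀ g, ‖ι g - 1‖ = dist1 g) (hL : 2 ≤ P.L)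
    {BgD : Type*} {dom : Set BgD} (fld : BgD → GaugeField P 0 G)
    {α' β' κ β'' κ₁ : ℝ} (hα0 : 0 ≤ α') (hα : α' ≤ 1 / 16) (hβ0 : 0 ≤ β') (hκ0 : 0 ≤ κ) (hκ1 : κ ≤ 1 / 64) (hβ''0 : 0 ≤ β'') (hκ₁0 : 0 ≤ κ₁)
    (hα' : ∀ b ∈ dom, ∀ c : PBond P 0, (P.L : ℝ) ^ P.K * dist1 (fld b c) ≤ α')
    (hβ' : ∀ b ∈ dom, ∀ (x : Site P 0) (ν μ : Fin P.d), (P.L : ℝ) ^ P.K * ‖ι (fld b ⟨x.shift μ, ν⟩) - ι (fld b ⟨x, ν⟩)‖ ≤ β' / (P.L : ℝ) ^ P.K)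
    (hβ'' : ∀ b ∈ dom, SecondOrderWindow P ι (fld b) β'')
    (hκ : ∀ b ∈ dom, ∀ (i k : ℕ), i + 1 + k = P.K → ∀ c : PBond P (i + 1), dist1 (corr ℰ (avgTower ℰ (fld b) i) c) * ((lev P.L k : ℕ) : ℝ) ^ 2 ≤ κ)
    (hκ₁ : ∀ b ∈ dom, ∀ (j k : ℕ), j + 1 + k = P.K → ∀ (x : Site P (j + 1)) (μ ν : Fin P.d),
      dist1 (corr ℰ (avgTower ℰ (fld b) j) ⟨x.shift ν, μ⟩ * (corr ℰ (avgTower ℰ (fld b) j) ⟨x, μ⟩)⁻¹) * ((lev P.L k : ℕ) : ℝ) ^ 3 ≤ κ₁) :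
    ∀ b ∈ dom, LocalRateOn (levelWindow P.K)
      (bgReadings P.L (unitMod P) (regClass P.L (unitMod P) (liftR P.L (unitMod P) (towerOfS P ι (avgTower ℰ (fld b))))))
      (max (κ * Real.exp (2 * α' + 8 * κ) + (2 * α' + 8 * κ) ^ 2 + (2 * P.d + 1) * (2 * β' + 16 * κ))
        ((2 * P.d + 2) * (2 * (β'' + 16 * β' ^ 2) + 8 * (κ₁ + 9 * κ * (2 * β' + 16 * κ)))
          + 4 / 3 * (κ₁ + (2 * α' + 9 * κ) * (2 * β' + 16 * κ)))
        + 2 * P.d * max (2 * β' + 16 * κ) (2 * (β'' + 16 * β' ^ 2) + 8 * (κ₁ + 9 * κ * (2 * β' + 16 * κ))))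
      ((P.L : ℝ)⁻¹) := fun b hb => by
  rw [liftR_towerOfS]
  exact hloc_avgTower_on_window5 P ι ℰ hι hdist hL (fld b) hα0 hα hβ0 hκ0 hκ1 hβ''0 hκ₁0 (hα' b hb) (hβ' b hb) (hβ'' b hb) (hκ b hb) (hκ₁ b hb)

end Summit.QuantumFields.BalabanUV.T4Continuum.SubstrateAvgTowerRegularityLetters

end
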